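import Summits.ValiantsHypothesis.ValiantsHypothesis.Theses.RyserTripartition
import Summits.ValiantsHypothesis.ValiantsHypothesis.Theorems.RyserTripartitionPerLeTripartitionLaplace
import Summits.ValiantsHypothesis.ValiantsHypothesis.Theorems.RyserTripartitionPerLeTripartitionPass
import HarnessLib

/-!
# ValiantsHypothesis / RyserTripartition — item `PerLeTripartition` (stmt-ValiantsHypothesis-11286), closed

**The bridge.** For every `k` and every fan-in-two circuit `Γ` computing the tripartition polynomial
`T_k = Σ_{S,T,U pairwise disjoint k-sets} X(0,S) X(1,T) X(2,U)`, there is a fan-in-two SYNTACTICALLY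
MULTILINEAR circuit computing `per_{3k}` of size `≤ 128·|Γ| + 128·(k+1)^128·C(3k,k)`:
(1) the block sub-permanent tables `q_i(S)` (`…Tables`: `≤ 6(k+1)² C(3k,k)` gates, supports in
the row blocks); (2) the set-multilinear homogenisation pass of `Γ` over the environment
`X(i,S) ↦ q_i(S)` (`…Pass`: `≤ 128·|Γ|` gates; every product multiplies components living in
disjoint row blocks, so the result is syntactically multilinear); (3) the output component of
multidegree `(1,1,1)` computes `T_k(q) = per_{3k}` because `T_k` is its own `(1,1,1)`-component and
by the three-row-block Laplace expansion (`…Laplace`: `aeval_tripartition_eq_permanent`).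
HONEST FRAMING: bookkeeping for a support item of a dormant route (`RyserTripartition`); the cruxes
it serves (Ryser-optimality, `TripartitionHard`) are OPEN and far beyond the state of the art;
nothing here is progress on `VP ≠ VNP`, which is NOT proved.
-/

-- layout Summits/ValiantsHypothesis/ValiantsHypothesis forces the duplicated namespace component
set_option linter.dupNamespace false

namespace Summit.ValiantsHypothesis.ValiantsHypothesis.Theorems.RyserTripartition

open Finset MvPolynomial Literature.Computability.AlgebraicComplexity
  Literature.Computability.AlgebraicComplexity.ArithCircuit
  Literature.Computability.AlgebraicComplexity.SynAvail
open Literature.Barriers.ValiantsHypothesis (IsPlainGate)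

/-- A bijection sum only depends on its row finset up to equality (transport along `P = P'`).
[folklore] -/
theorem blockSum_congr {k : ℕ} {P P' : Finset (Fin (3 * k))} (h : P = P') (S : Finset (Fin (3 * k))) :
    (∑ b : ↥P ≃ ↥S, ∏ p : ↥P, (X ((p : Fin (3 * k)), ((b p : ↥S) : Fin (3 * k))) :
        MvPolynomial (Fin (3 * k) × Fin (3 * k)) ℂ)) =
      ∑ b : ↥P' ≃ ↥S, ∏ p : ↥P', (X ((p : Fin (3 * k)), ((b p : ↥S) : Fin (3 * k))) :
        MvPolynomial (Fin (3 * k) × Fin (3 * k)) ℂ) := by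
  subst h; rfl

/-- The tripartition polynomial `T_k` is group-multilinear of multidegree `(1,1,1)`: it is
weighted homogeneous of weight `𝟙_{Fin 3}` for the group grading. [folklore] -/
theorem tripartition_isWeightedHomogeneous (k : ℕ) :
    IsWeightedHomogeneous
      (fun v : Fin 3 × {A : Finset (Fin (3 * k)) // A.card = k} => (Finsupp.single v.1 1 : Fin 3 →₀ ℕ))
      (∑ S : {A : Finset (Fin (3 * k)) // A.card = k}, ∑ T : {A : Finset (Fin (3 * k)) // A.card = k},
        ∑ U : {A : Finset (Fin (3 * k)) // A.card = k},
          if Disjoint S.1 T.1 ∧ Disjoint S.1 U.1 ∧ Disjoint T.1 U.1 then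
            (MvPolynomial.X (0, S) * MvPolynomial.X (1, T) * MvPolynomial.X (2, U) :
              MvPolynomial (Fin 3 × {A : Finset (Fin (3 * k)) // A.card = k}) ℂ)
          else 0)
      (∑ j ∈ (Finset.univ : Finset (Fin 3)), Finsupp.single j 1) := by
  refine IsWeightedHomogeneous.sum _ _ _ fun S _ => ?_
  refine IsWeightedHomogeneous.sum _ _ _ fun T _ => ?_
  refine IsWeightedHomogeneous.sum _ _ _ fun U _ => ?_
  split_ifs
  · have h := ((isWeightedHomogeneous_X ℂ
        (fun v : Fin 3 × {A : Finset (Fin (3 * k)) // A.card = k} =>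
          (Finsupp.single v.1 1 : Fin 3 →₀ ℕ)) (0, S)).mul
      (isWeightedHomogeneous_X ℂ _ (1, T))).mul (isWeightedHomogeneous_X ℂ _ (2, U))
    have hw : (Finsupp.single (0 : Fin 3) 1 : Fin 3 →₀ ℕ) + Finsupp.single 1 1 + Finsupp.single 2 1 =
        ∑ j ∈ (Finset.univ : Finset (Fin 3)), Finsupp.single j 1 := by
      rw [Fin.sum_univ_three]
    rw [← hw]
    exact h
  · exact isWeightedHomogeneous_zero _ _ _

/-- **`PerLeTripartition`** (item stmt-ValiantsHypothesis-11286), with `c = 128`. [folklore] -/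
theorem perLeTripartition_proof :
    Summit.ValiantsHypothesis.ValiantsHypothesis.Theses.RyserTripartition.PerLeTripartition := by
  classical
  refine ⟨128, fun k Γ hΓ => ?_⟩
  obtain ⟨h2, hcomp⟩ := hΓ
  -- (1) the tables
  obtain ⟨gs₀, hg₀, hm₀, hl₀, hav₀⟩ := tables (R := ℂ) k
  -- the environment: X(i, S) ↦ q_i(S), supports in the row blocks
  let Y : Fin 3 → Finset (Fin (3 * k) × Fin (3 * k)) := fun i =>
    ((Finset.univ : Finset (Fin (3 * k))).filter
      (fun r : Fin (3 * k) => (i : ℕ) * k ≤ (r : ℕ) ∧ (r : ℕ) < (i : ℕ) * k + k)) ×ˢ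
      (Finset.univ : Finset (Fin (3 * k)))
  let φ : Fin 3 × {A : Finset (Fin (3 * k)) // A.card = k} →
      MvPolynomial (Fin (3 * k) × Fin (3 * k)) ℂ := fun v =>
    ∑ b : ↥((Finset.univ : Finset (Fin (3 * k))).filter
        (fun r : Fin (3 * k) => (v.1 : ℕ) * k ≤ (r : ℕ) ∧ (r : ℕ) < (v.1 : ℕ) * k + k)) ≃ ↥v.2.1,
      ∏ p : ↥((Finset.univ : Finset (Fin (3 * k))).filter
        (fun r : Fin (3 * k) => (v.1 : ℕ) * k ≤ (r : ℕ) ∧ (r : ℕ) < (v.1 : ℕ) * k + k)),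
        (X ((p : Fin (3 * k)), ((b p : ↥v.2.1) : Fin (3 * k))) :
          MvPolynomial (Fin (3 * k) × Fin (3 * k)) ℂ)
  have hY : ∀ i j : Fin 3, i ≠ j → Disjoint (Y i) (Y j) := by
    intro i j hij
    rw [Finset.disjoint_product]
    left
    rw [Finset.disjoint_filter]
    intro r _ h1 h2
    have : (i : ℕ) ≠ (j : ℕ) := fun h => hij (Fin.ext h)
    rcases Nat.lt_or_gt_of_ne this with h | h
    · nlinarith [h1.1, h1.2, h2.1, h2.2]
    · nlinarith [h1.1, h1.2, h2.1, h2.2]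
  have henv : ∀ v : Fin 3 × {A : Finset (Fin (3 * k)) // A.card = k},
      ∃ u : Operand ℂ (Fin (3 * k) × Fin (3 * k)), u.RefsBelow gs₀.length ∧
        u.eval (gateValues gs₀) = φ v ∧ operandVarSet (gateVarSets gs₀) u ⊆ Y v.1 :=
    fun v => hav₀ v.1 v.1.isLt v.2.1 v.2.2
  -- (2) the homogenisation pass
  obtain ⟨gs, hp, hg, hm, hl, hr⟩ := Pass.pass_gates φ Y hY gs₀ hg₀ hm₀ henv Γ.gates h2
  -- (3) the output component of multidegree (1,1,1)
  obtain ⟨u, hu, hue, -⟩ := Pass.av_operand φ Y gs (fun v => savail_mono hp (henv v))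
    (gateValues Γ.gates) hr Γ.output (Finset.univ : Finset (Fin 3))
  refine ⟨⟨gs, u⟩, fun g hg' => (hg g hg').1, isSyntacticallyMultilinear_of_prodInv hm u, ?_, ?_⟩
  · -- P computes per_{3k}
    change u.eval (gateValues gs) = perPoly (Fin (3 * k)) ℂ
    have hT : Γ.output.eval (gateValues Γ.gates) = _ := hcomp
    rw [hue, hT, (tripartition_isWeightedHomogeneous k).weightedHomogeneousComponent_same]
    -- compare the environment with the Laplace file's block sums and conclude
    unfold Literature.Computability.AlgebraicComplexity.perPoly
    rw [← aeval_tripartition_eq_permanent (R := ℂ) k (Matrix.mvPolynomialX (Fin (3 * k)) (Fin (3 * k)) ℂ)]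
    congr 1
    congr 1
    funext v
    obtain ⟨i, S⟩ := v
    have hB0 : (Finset.univ : Finset (Fin (3 * k))).filter
          (fun r : Fin (3 * k) => ((0 : Fin 3) : ℕ) * k ≤ (r : ℕ) ∧ (r : ℕ) < ((0 : Fin 3) : ℕ) * k + k) =
        (Finset.univ : Finset (Fin (3 * k))).filter (fun r : Fin (3 * k) => (r : ℕ) < k) := by
      ext r; simp
    have hB1 : (Finset.univ : Finset (Fin (3 * k))).filter
          (fun r : Fin (3 * k) => ((1 : Fin 3) : ℕ) * k ≤ (r : ℕ) ∧ (r : ℕ) < ((1 : Fin 3) : ℕ) * k + k) =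
        (Finset.univ : Finset (Fin (3 * k))).filter
          (fun r : Fin (3 * k) => k ≤ (r : ℕ) ∧ (r : ℕ) < 2 * k) := by
      ext r; simp only [Fin.val_one, Finset.mem_filter, Finset.mem_univ, true_and]; omega
    have hB2 : (Finset.univ : Finset (Fin (3 * k))).filter
          (fun r : Fin (3 * k) => ((2 : Fin 3) : ℕ) * k ≤ (r : ℕ) ∧ (r : ℕ) < ((2 : Fin 3) : ℕ) * k + k) =
        (((Finset.univ : Finset (Fin (3 * k))).filter (fun r : Fin (3 * k) => (r : ℕ) < k)) ∪
          ((Finset.univ : Finset (Fin (3 * k))).filter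
            (fun r : Fin (3 * k) => k ≤ (r : ℕ) ∧ (r : ℕ) < 2 * k)))ᶜ := by
      ext r
      simp only [Fin.val_two, Finset.mem_filter, Finset.mem_univ, true_and, Finset.mem_compl,
        Finset.mem_union, not_or, not_lt, not_and]
      have := r.isLt
      omega
    have hiv : i = 0 ∨ i = 1 ∨ i = 2 := by fin_cases i <;> simp
    rcases hiv with rfl | rfl | rfl
    · exact blockSum_congr hB0 S.1
    · exact blockSum_congr hB1 S.1
    · exact blockSum_congr hB2 S.1
  · -- size
    change gs.length ≤ 128 * Γ.gates.length + 128 * (k + 1) ^ 128 * Nat.choose (3 * k) k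
    have hpow : (k + 1) ^ 2 ≤ (k + 1) ^ 128 := Nat.pow_le_pow_right (Nat.succ_pos k) (by norm_num)
    have h6 : 6 * (k + 1) ^ 2 * Nat.choose (3 * k) k ≤ 128 * (k + 1) ^ 128 * Nat.choose (3 * k) k :=
      Nat.mul_le_mul (Nat.mul_le_mul (by norm_num) hpow) le_rfl
    omega

end Summit.ValiantsHypothesis.ValiantsHypothesis.Theorems.RyserTripartition
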